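import Literature.NumberTheory.Sieve.HeathBrownCubicPolar
import Literature.Algebra.EuclideanLattices.LatticePointCounting
import Mathlib.Analysis.Calculus.ContDiff.RCLike
import Mathlib.MeasureTheory.Measure.Lebesgue.Complex
import Mathlib.MeasureTheory.Group.Prod
import HarnessLib

/-!
# Lattice points of `ℤ[∛2]` in sectors of `W = ℝ × ℂ`: uniform counts and equal volumes

Continuation of `HeathBrownCubicPolar` (polar coordinates, sectors `sector a b = polarMap((0,1] × [a,b])`,
unit flow and rotations) towards the **twisted ideal counts** of `K = ℚ(∛2)` needed for Mitsui's prime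
number theorem with Grössencharakteren (T. Mitsui, Jap. J. Math. 26 (1956), Lemma 5) = Lemma 9.4 of
D. R. Heath-Brown, *Primes represented by `x³ + 2y³`*, Acta Math. 186 (2001), §9. Everything is PROVED
(definitions: the six face maps `faceMap`, the coordinate equivalence `coordEquiv`, the bases
`stdBasis3`, `basisW`, the linear isomorphism `embWEquiv`, and the Haar instance for `volume` on `W`).

* **Frontier of a sector.** `frontier_sector_subset`: the frontier of `sector a b` (angles in
  `[−π, π]`) lies in `polarMap(∂ box)` — the closure is inside the compact image of the closed box,
  and the image of the open box is open (`isOpen_image_polarMap_openBox`, as the preimage of the open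
  box under the polar coordinates, continuous on `{w₁ > 0, w₂ ∉ (−∞,0]}`, `continuousOn_wCoord`);
  `diff_subset_iUnion_faceMap`: `∂ box` is covered by six affine images of the unit square, each
  `(2 + 2π)`-Lipschitz uniformly in the box (`lipschitzWith_faceMap`).
* **Uniform covers.** `exists_lipschitzOnWith_polarMap` (`C¹` on a convex compact set) and
  `exists_cover_frontier_sector`: ONE constant `C` such that for all boxes `(0,−π) ≤ a ≤ b ≤ (1,π)`,
  all `t ≥ 1` and all translations `c`, `frontier(t·sector a b + c)` is covered by `≤ C t²` unit balls
  (Marcus's subdivision `exists_cover_image_cube`).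
* **The lattice.** `basisW` = the images under the Minkowski embedding `embW` of the standard basis
  of `ℤ³`; `mem_span_basisW_iff`: its `ℤ`-span is exactly `embW(ℤ³) = 𝓞_K`;
  `ncard_preimage_eq_card_inter`: counting integer vectors `v` with `embW v̂ ∈ S` is counting lattice
  points in `S`.
* **Uniform count.** `exists_uniform_sector_count`: ONE `C` with
  `|#(𝓞_K ∩ (t·sector a b + c)) − vol(sector a b) t³/covol| ≤ C t²` for all such boxes, `t ≥ 1`, `c`
  (the tree's `abs_card_sub_div_le_of_cover`, Marcus Ch. 6 Lemma 2, plus `volume_image_smul_add`).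
* **Equal volumes.** `volume_sector_add`: `vol(sector (a+d) (b+d)) = vol(sector a b)` — the translate
  of the box is reached by the unit flow and a rotation, both of determinant `1`
  (`Measure.addHaar_image_linearMap`); so all boxes of a uniform grid give sectors of equal volume,
  which is what makes the main terms of a nontrivial character sum cancel exactly downstream.

## References

* D. A. Marcus, *Number Fields*, 2nd ed., Springer 2018, Ch. 6, Lemma 2 and its proof.
  [cite: Marcus2018, Ch. 6, Lemma 2]
* D. R. Heath-Brown, *Primes represented by `x³ + 2y³`*, Acta Math. 186 (2001), §9 p. 53, §11 (11.3).
  [cite: HeathBrownActa2001, §9 p. 53]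

## Mathlib / tree search

Tree: `HeathBrownCubicPolar` (everything polar), `Literature.Algebra.EuclideanLattices`
(`abs_card_sub_div_le_of_cover`, `exists_cover_image_cube`, `lipschitzOnWith_smul`, `frontier_smul`,
`cellRadius`, `mem_cube_iff`). Mathlib: `ContDiffOn.exists_lipschitzOnWith`, `LipschitzWith.prodMk`,
`LipschitzWith.eval`, `Homeomorph.image_frontier`, `ContinuousOn.isOpen_inter_preimage`,
`Complex.continuousAt_arg`, `Complex.mem_slitPlane_iff_arg`, `LinearMap.linearEquivOfInjective`,
`Basis.ofEquivFun`, `Basis.map`, `Basis.mem_span_iff_repr_mem`, `Measure.addHaar_smul_of_nonneg`,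
`measure_preimage_add_right`, `Measure.addHaar_image_linearMap`, `Measure.prod.instIsAddHaarMeasure`
(the instance for `volume` on `ℝ × ℂ` is not found by `inferInstance`; registered here).
-/

noncomputable section

open Complex Set Metric
open scoped NNReal Pointwise

namespace Literature.NumberTheory.Sieve.CubicSieve


/-- The open set `{w₁ > 0, w₂ ∈ ℂ ∖ (−∞, 0]}` on which the polar coordinates are continuous. [folklore] -/
theorem isOpen_polarDomain : IsOpen {w : ℝ × ℂ | 0 < w.1 ∧ w.2 ∈ Complex.slitPlane} :=
  (isOpen_lt continuous_const continuous_fst).inter (Complex.isOpen_slitPlane.preimage continuous_snd)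

/-- `wNorm` is continuous. [folklore] -/
theorem continuous_wNorm : Continuous wNorm :=
  continuous_fst.mul (Complex.continuous_normSq.comp continuous_snd)

/-- `wU` is continuous. [folklore] -/
theorem continuous_wU : Continuous wU :=
  continuous_wNorm.rpow_const fun _ ↦ Or.inr (by norm_num)

/-- The polar coordinates `w ↦ (u(w), r(w), arg w₂)` are continuous on the polar domain. [folklore] -/
theorem continuousOn_wCoord :
    ContinuousOn (fun w : ℝ × ℂ ↦ (wU w, wR w, Complex.arg w.2))
      {w : ℝ × ℂ | 0 < w.1 ∧ w.2 ∈ Complex.slitPlane} := by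
  refine continuous_wU.continuousOn.prodMk (ContinuousOn.prodMk ?_ ?_)
  · have hU : ∀ w ∈ {w : ℝ × ℂ | 0 < w.1 ∧ w.2 ∈ Complex.slitPlane}, wU w ≠ 0 := fun w hw ↦
      (wU_pos hw.1 (Complex.slitPlane_ne_zero hw.2)).ne'
    have hdiv : ContinuousOn (fun w : ℝ × ℂ ↦ w.1 / wU w) {w | 0 < w.1 ∧ w.2 ∈ Complex.slitPlane} :=
      continuous_fst.continuousOn.div continuous_wU.continuousOn hU
    refine (hdiv.log fun w hw ↦ ?_).div_const _
    exact (div_pos hw.1 (wU_pos hw.1 (Complex.slitPlane_ne_zero hw.2))).ne'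
  · intro w hw
    exact (Complex.continuousAt_arg hw.2).comp_continuousWithinAt continuous_snd.continuousWithinAt

/-- **The image of the open parameter box is described by the coordinates**: for angles within
`[−π, π]`, `polarMap '' ((0,1) × (a₁,b₁) × (a₂,b₂))` is the set of `w` in the polar domain whose
coordinates lie in the open box. [folklore] -/
theorem image_polarMap_openBox {a b : ℝ × ℝ} (ha : -Real.pi ≤ a.2) (hb : b.2 ≤ Real.pi) :
    polarMap '' (Set.Ioo (0 : ℝ) 1 ×ˢ (Set.Ioo a.1 b.1 ×ˢ Set.Ioo a.2 b.2)) =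
      {w : ℝ × ℂ | 0 < w.1 ∧ w.2 ∈ Complex.slitPlane} ∩
        (fun w : ℝ × ℂ ↦ (wU w, wR w, Complex.arg w.2)) ⁻¹'
          (Set.Ioo (0 : ℝ) 1 ×ˢ (Set.Ioo a.1 b.1 ×ˢ Set.Ioo a.2 b.2)) := by
  ext w
  simp only [Set.mem_image, Set.mem_prod, Set.mem_Ioo, Set.mem_inter_iff, Set.mem_setOf_eq,
    Set.mem_preimage]
  constructor
  · rintro ⟨p, ⟨hu, hr, hφ⟩, rfl⟩
    have hφ' : p.2.2 ∈ Set.Ioc (-Real.pi) Real.pi := ⟨by linarith [hφ.1], by linarith [hφ.2]⟩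
    have harg := arg_polarMap_snd hu.1 hφ'
    refine ⟨⟨polarMap_fst_pos hu.1, ?_⟩, ?_⟩
    · rw [Complex.mem_slitPlane_iff_arg]
      exact ⟨by rw [harg]; linarith [hφ.2], polarMap_snd_ne_zero hu.1⟩
    · rw [wU_polarMap hu.1.le, wR_polarMap hu.1, harg]
      exact ⟨hu, hr, hφ⟩
  · rintro ⟨⟨h1, h2⟩, hbox⟩
    exact ⟨(wU w, wR w, Complex.arg w.2), hbox, polarMap_wCoord h1 (Complex.slitPlane_ne_zero h2)⟩

/-- The image of the open parameter box is open (angles within `[−π, π]`). [folklore] -/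
theorem isOpen_image_polarMap_openBox {a b : ℝ × ℝ} (ha : -Real.pi ≤ a.2) (hb : b.2 ≤ Real.pi) :
    IsOpen (polarMap '' (Set.Ioo (0 : ℝ) 1 ×ˢ (Set.Ioo a.1 b.1 ×ˢ Set.Ioo a.2 b.2))) := by
  rw [image_polarMap_openBox ha hb]
  exact continuousOn_wCoord.isOpen_inter_preimage isOpen_polarDomain
    (isOpen_Ioo.prod (isOpen_Ioo.prod isOpen_Ioo))

/-- **The frontier of a sector lies in the image of the boundary of the parameter box**
(closure inside the compact image of the closed box, interior containing the open image of the
open box). [folklore] -/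
theorem frontier_sector_subset {a b : ℝ × ℝ} (ha : -Real.pi ≤ a.2) (hb : b.2 ≤ Real.pi) :
    frontier (sector a b) ⊆
      polarMap '' ((Set.Icc (0 : ℝ) 1 ×ˢ Set.Icc a b) \
        (Set.Ioo (0 : ℝ) 1 ×ˢ (Set.Ioo a.1 b.1 ×ˢ Set.Ioo a.2 b.2))) := by
  have hcl : closure (sector a b) ⊆ polarMap '' (Set.Icc (0 : ℝ) 1 ×ˢ Set.Icc a b) :=
    closure_minimal (sector_subset_image_Icc a b)
      (((isCompact_Icc.prod isCompact_Icc).image continuous_polarMap).isClosed)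
  have hint : polarMap '' (Set.Ioo (0 : ℝ) 1 ×ˢ (Set.Ioo a.1 b.1 ×ˢ Set.Ioo a.2 b.2)) ⊆
      interior (sector a b) := by
    refine interior_maximal (Set.image_mono ?_) (isOpen_image_polarMap_openBox ha hb)
    rintro ⟨u, r, φ⟩ ⟨hu, hr, hφ⟩
    exact ⟨⟨hu.1, hu.2.le⟩, ⟨⟨hr.1.le, hφ.1.le⟩, ⟨hr.2.le, hφ.2.le⟩⟩⟩
  intro w hw
  have hw1 : w ∈ closure (sector a b) := hw.1
  have hw2 : w ∉ interior (sector a b) := hw.2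
  have hw2' : w ∉ polarMap '' (Set.Ioo (0 : ℝ) 1 ×ˢ (Set.Ioo a.1 b.1 ×ˢ Set.Ioo a.2 b.2)) :=
    fun h ↦ hw2 (hint h)
  obtain ⟨p, hp, rfl⟩ := hcl hw1
  exact ⟨p, ⟨hp, fun hpt ↦ hw2' ⟨p, hpt, rfl⟩⟩, rfl⟩

/-! ### The six faces of the parameter box -/

/-- `q ↦ c + q i · d` on the cube is `|d|`-Lipschitz. [folklore] -/
theorem lipschitzWith_coord_affine (i : Fin 2) (c d : ℝ) :
    LipschitzWith ‖d‖₊ (fun q : Fin 2 → ℝ ↦ c + q i * d) := by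
  refine LipschitzWith.of_dist_le_mul fun q q' ↦ ?_
  rw [Real.dist_eq, show c + q i * d - (c + q' i * d) = (q i - q' i) * d by ring, abs_mul,
    ← Real.dist_eq, mul_comm, coe_nnnorm, Real.norm_eq_abs]
  exact mul_le_mul_of_nonneg_left (dist_le_pi_dist q q' i) (abs_nonneg d)

/-- **The faces**: the six affine parametrisations of the faces `u = 0`, `u = 1`, `r = a₁`, `r = b₁`,
`φ = a₂`, `φ = b₂` of the box `[0,1] × [a, b]` by the unit square. [folklore] -/
def faceMap (a b : ℝ × ℝ) : Fin 6 → (Fin 2 → ℝ) → ℝ × ℝ × ℝ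
  | ⟨0, _⟩ => fun q ↦ (0, a.1 + q 0 * (b.1 - a.1), a.2 + q 1 * (b.2 - a.2))
  | ⟨1, _⟩ => fun q ↦ (1, a.1 + q 0 * (b.1 - a.1), a.2 + q 1 * (b.2 - a.2))
  | ⟨2, _⟩ => fun q ↦ (q 0, a.1, a.2 + q 1 * (b.2 - a.2))
  | ⟨3, _⟩ => fun q ↦ (q 0, b.1, a.2 + q 1 * (b.2 - a.2))
  | ⟨4, _⟩ => fun q ↦ (q 0, a.1 + q 1 * (b.1 - a.1), a.2)
  | ⟨5, _⟩ => fun q ↦ (q 0, a.1 + q 1 * (b.1 - a.1), b.2)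

/-- Each face map is Lipschitz with the uniform constant `1 + |b₁ − a₁| + |b₂ − a₂|`. [folklore] -/
theorem lipschitzWith_faceMap (a b : ℝ × ℝ) (k : Fin 6) :
    LipschitzWith (1 + ‖b.1 - a.1‖₊ + ‖b.2 - a.2‖₊) (faceMap a b k) := by
  set D : ℝ≥0 := 1 + ‖b.1 - a.1‖₊ + ‖b.2 - a.2‖₊ with hD
  have hD1 : (1 : ℝ≥0) ≤ D := by rw [hD]; exact le_add_right le_self_add
  have hD2 : ‖b.1 - a.1‖₊ ≤ D := by rw [hD]; exact le_add_right le_add_self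
  have hD3 : ‖b.2 - a.2‖₊ ≤ D := by rw [hD]; exact le_add_self
  have hD0 : (0 : ℝ≥0) ≤ D := bot_le
  -- the building blocks
  have hc : ∀ c : ℝ, LipschitzWith D (fun _ : Fin 2 → ℝ ↦ c) := fun c ↦
    (LipschitzWith.const c).weaken hD0
  have hq0 : LipschitzWith D (fun q : Fin 2 → ℝ ↦ q 0) :=
    (LipschitzWith.eval (α := fun _ : Fin 2 ↦ ℝ) 0).weaken hD1
  have hr : ∀ i, LipschitzWith D (fun q : Fin 2 → ℝ ↦ a.1 + q i * (b.1 - a.1)) := fun i ↦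
    (lipschitzWith_coord_affine i a.1 (b.1 - a.1)).weaken hD2
  have hφ : ∀ i, LipschitzWith D (fun q : Fin 2 → ℝ ↦ a.2 + q i * (b.2 - a.2)) := fun i ↦
    (lipschitzWith_coord_affine i a.2 (b.2 - a.2)).weaken hD3
  have hmax : max D (max D D) = D := by simp
  match k with
  | ⟨0, _⟩ => simpa [faceMap, hmax] using (hc 0).prodMk ((hr 0).prodMk (hφ 1))
  | ⟨1, _⟩ => simpa [faceMap, hmax] using (hc 1).prodMk ((hr 0).prodMk (hφ 1))
  | ⟨2, _⟩ => simpa [faceMap, hmax] using hq0.prodMk ((hc a.1).prodMk (hφ 1))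
  | ⟨3, _⟩ => simpa [faceMap, hmax] using hq0.prodMk ((hc b.1).prodMk (hφ 1))
  | ⟨4, _⟩ => simpa [faceMap, hmax] using hq0.prodMk ((hr 1).prodMk (hc a.2))
  | ⟨5, _⟩ => simpa [faceMap, hmax] using hq0.prodMk ((hr 1).prodMk (hc b.2))

/-- **The boundary of the parameter box is covered by the six faces** (for `a ≤ b`). [folklore] -/
theorem diff_subset_iUnion_faceMap {a b : ℝ × ℝ} (hab : a ≤ b) :
    (Set.Icc (0 : ℝ) 1 ×ˢ Set.Icc a b) \ (Set.Ioo (0 : ℝ) 1 ×ˢ (Set.Ioo a.1 b.1 ×ˢ Set.Ioo a.2 b.2)) ⊆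
      ⋃ k, faceMap a b k '' Set.Icc (0 : Fin 2 → ℝ) 1 := by
  rintro ⟨u, r, φ⟩ ⟨hmem, hnot⟩
  simp only [Set.mem_prod, Set.mem_Icc, Prod.le_def] at hmem
  obtain ⟨⟨hu0, hu1⟩, ⟨hra, hφa⟩, ⟨hrb, hφb⟩⟩ := hmem
  simp only [Set.mem_prod, Set.mem_Ioo, not_and_or, not_lt] at hnot
  have hab1 : a.1 ≤ b.1 := hab.1
  have hab2 : a.2 ≤ b.2 := hab.2
  -- normalised coordinates in `[0,1]` with `a.1 + s (b.1 - a.1) = r`, `a.2 + s' (b.2 - a.2) = φ`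
  obtain ⟨s, hs01, hrs⟩ : ∃ s : ℝ, s ∈ Set.Icc (0 : ℝ) 1 ∧ a.1 + s * (b.1 - a.1) = r := by
    rcases eq_or_lt_of_le hab1 with h | h
    · refine ⟨0, ⟨le_rfl, zero_le_one⟩, ?_⟩
      have : r = a.1 := by rw [← h] at hrb; linarith
      rw [this]; ring
    · refine ⟨(r - a.1) / (b.1 - a.1), ⟨div_nonneg (by linarith) (by linarith),
        (div_le_one (by linarith)).2 (by linarith)⟩, ?_⟩
      field_simp; ring
  obtain ⟨s', hs'01, hφs⟩ : ∃ s' : ℝ, s' ∈ Set.Icc (0 : ℝ) 1 ∧ a.2 + s' * (b.2 - a.2) = φ := by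
    rcases eq_or_lt_of_le hab2 with h | h
    · refine ⟨0, ⟨le_rfl, zero_le_one⟩, ?_⟩
      have : φ = a.2 := by rw [← h] at hφb; linarith
      rw [this]; ring
    · refine ⟨(φ - a.2) / (b.2 - a.2), ⟨div_nonneg (by linarith) (by linarith),
        (div_le_one (by linarith)).2 (by linarith)⟩, ?_⟩
      field_simp; ring
  -- the cube point with two prescribed coordinates
  have cube : ∀ x y : ℝ, x ∈ Set.Icc (0 : ℝ) 1 → y ∈ Set.Icc (0 : ℝ) 1 →
      (![x, y] : Fin 2 → ℝ) ∈ Set.Icc (0 : Fin 2 → ℝ) 1 := by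
    intro x y hx hy
    rw [Literature.Algebra.EuclideanLattices.mem_cube_iff]
    intro i; fin_cases i <;> simp [hx.1, hx.2, hy.1, hy.2]
  simp only [Set.mem_iUnion, Set.mem_image]
  rcases hnot with (hu | hu) | ((hr | hr) | (hφ | hφ))
  · have hu00 : u = 0 := le_antisymm hu hu0
    exact ⟨0, ![s, s'], cube s s' hs01 hs'01, by simp [faceMap, hrs, hφs, hu00]⟩
  · have hu11 : u = 1 := le_antisymm hu1 hu
    exact ⟨1, ![s, s'], cube s s' hs01 hs'01, by simp [faceMap, hrs, hφs, hu11]⟩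
  · have : r = a.1 := le_antisymm hr hra
    exact ⟨2, ![u, s'], cube u s' ⟨hu0, hu1⟩ hs'01, by simp [faceMap, this, hφs]⟩
  · have : r = b.1 := le_antisymm hrb hr
    exact ⟨3, ![u, s'], cube u s' ⟨hu0, hu1⟩ hs'01, by simp [faceMap, this, hφs]⟩
  · have : φ = a.2 := le_antisymm hφ hφa
    exact ⟨4, ![u, s], cube u s ⟨hu0, hu1⟩ hs01, by simp [faceMap, this, hrs]⟩
  · have : φ = b.2 := le_antisymm hφb hφ
    exact ⟨5, ![u, s], cube u s ⟨hu0, hu1⟩ hs01, by simp [faceMap, this, hrs]⟩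

/-- Points `a.1 + x (b.1 − a.1)`, `x ∈ [0,1]`, lie in `[a.1, b.1]` (`a.1 ≤ b.1`); both coordinates.
[folklore] -/
theorem affine_mem_Icc {lo hi x : ℝ} (hle : lo ≤ hi) (hx : x ∈ Set.Icc (0 : ℝ) 1) :
    lo ≤ lo + x * (hi - lo) ∧ lo + x * (hi - lo) ≤ hi := by
  constructor <;> nlinarith [hx.1, hx.2]

/-- The faces lie in the closed parameter box `[0,1] × [a,b]` (`a ≤ b`). [folklore] -/
theorem faceMap_mem_box {a b : ℝ × ℝ} (hab : a ≤ b) (k : Fin 6) {q : Fin 2 → ℝ}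
    (hq : q ∈ Set.Icc (0 : Fin 2 → ℝ) 1) : faceMap a b k q ∈ Set.Icc (0 : ℝ) 1 ×ˢ Set.Icc a b := by
  rw [Literature.Algebra.EuclideanLattices.mem_cube_iff] at hq
  have h0 := hq 0
  have h1 := hq 1
  have hab1 : a.1 ≤ b.1 := hab.1
  have hab2 : a.2 ≤ b.2 := hab.2
  have hr0 := affine_mem_Icc hab1 h0
  have hr1 := affine_mem_Icc hab1 h1
  have hφ0 := affine_mem_Icc hab2 h0
  have hφ1 := affine_mem_Icc hab2 h1
  rw [Set.mem_prod, Set.mem_Icc, Set.mem_Icc, Prod.le_def, Prod.le_def]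
  match k with
  | ⟨0, _⟩ => exact ⟨⟨le_rfl, zero_le_one⟩, ⟨hr0.1, hφ1.1⟩, ⟨hr0.2, hφ1.2⟩⟩
  | ⟨1, _⟩ => exact ⟨⟨zero_le_one, le_rfl⟩, ⟨hr0.1, hφ1.1⟩, ⟨hr0.2, hφ1.2⟩⟩
  | ⟨2, _⟩ => exact ⟨⟨h0.1, h0.2⟩, ⟨le_rfl, hφ1.1⟩, ⟨hab1, hφ1.2⟩⟩
  | ⟨3, _⟩ => exact ⟨⟨h0.1, h0.2⟩, ⟨hab1, hφ1.1⟩, ⟨le_rfl, hφ1.2⟩⟩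
  | ⟨4, _⟩ => exact ⟨⟨h0.1, h0.2⟩, ⟨hr1.1, le_rfl⟩, ⟨hr1.2, hab2⟩⟩
  | ⟨5, _⟩ => exact ⟨⟨h0.1, h0.2⟩, ⟨hr1.1, hab2⟩, ⟨hr1.2, le_rfl⟩⟩

/-! ### Lipschitz bounds and covers of the frontier, uniformly in the box -/

/-- The big parameter box `[0,1] × [0,1] × [−π, π]`. [folklore] -/
theorem isCompact_bigBox :
    IsCompact (Set.Icc (0 : ℝ) 1 ×ˢ (Set.Icc (0 : ℝ) 1 ×ˢ Set.Icc (-Real.pi) Real.pi)) :=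
  isCompact_Icc.prod (isCompact_Icc.prod isCompact_Icc)

/-- **`polarMap` is Lipschitz on the big parameter box** (it is `C¹` on a convex compact set).
[folklore] -/
theorem exists_lipschitzOnWith_polarMap :
    ∃ K : ℝ≥0, LipschitzOnWith K polarMap
      (Set.Icc (0 : ℝ) 1 ×ˢ (Set.Icc (0 : ℝ) 1 ×ˢ Set.Icc (-Real.pi) Real.pi)) :=
  (contDiff_polarMap (n := 1)).contDiffOn.exists_lipschitzOnWith one_ne_zero
    ((convex_Icc _ _).prod ((convex_Icc _ _).prod (convex_Icc _ _))) isCompact_bigBox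

/-- A parameter box `[a, b]` with `(0, −π) ≤ a ≤ b ≤ (1, π)` lies in `[0,1] × [−π,π]`, so the faces map
the unit square into the big box. [folklore] -/
theorem faceMap_mem_bigBox {a b : ℝ × ℝ} (ha : ((0 : ℝ), -Real.pi) ≤ a) (hab : a ≤ b)
    (hb : b ≤ ((1 : ℝ), Real.pi)) (k : Fin 6) {q : Fin 2 → ℝ} (hq : q ∈ Set.Icc (0 : Fin 2 → ℝ) 1) :
    faceMap a b k q ∈ Set.Icc (0 : ℝ) 1 ×ˢ (Set.Icc (0 : ℝ) 1 ×ˢ Set.Icc (-Real.pi) Real.pi) := by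
  have h := faceMap_mem_box hab k hq
  simp only [Set.mem_prod, Set.mem_Icc, Prod.le_def] at h ha hb ⊢
  obtain ⟨hu, ⟨h1, h2⟩, ⟨h3, h4⟩⟩ := h
  exact ⟨hu, ⟨ha.1.trans h1, h3.trans hb.1⟩, ⟨ha.2.trans h2, h4.trans hb.2⟩⟩

/-- **Covering the frontier of a scaled, translated sector**, uniformly in the box: there is `C`
such that for all boxes `(0,−π) ≤ a ≤ b ≤ (1,π)`, all `t ≥ 1` and all translations `c`,
`frontier (t·sector a b + c)` is covered by at most `C t²` closed unit balls.
[cite: Marcus2018, Ch. 6, proof of Lemma 2] -/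
theorem exists_cover_frontier_sector :
    ∃ C : ℝ, 0 ≤ C ∧ ∀ a b : ℝ × ℝ, ((0 : ℝ), -Real.pi) ≤ a → a ≤ b → b ≤ ((1 : ℝ), Real.pi) →
      ∀ t : ℝ, 1 ≤ t → ∀ c : ℝ × ℂ, ∃ Y : Finset (ℝ × ℂ), (Y.card : ℝ) ≤ C * t ^ 2 ∧
        frontier ((fun w ↦ t • w + c) '' sector a b) ⊆ ⋃ y ∈ Y, Metric.closedBall y 1 := by
  classical
  obtain ⟨K, hK⟩ := exists_lipschitzOnWith_polarMap
  -- the uniform face constant `D₀ = 2 + 2π`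
  set D₀ : ℝ≥0 := 1 + 1 + ‖(2 * Real.pi : ℝ)‖₊ with hD₀
  refine ⟨6 * ((K : ℝ) * D₀ + 3) ^ 2, by positivity, fun a b ha hab hb t ht c ↦ ?_⟩
  have ht0 : 0 ≤ t := by linarith
  have htne : t ≠ 0 := by linarith
  -- each scaled face piece is Lipschitz with constant `t K D₀`
  have hD : 1 + ‖b.1 - a.1‖₊ + ‖b.2 - a.2‖₊ ≤ D₀ := by
    rw [Prod.le_def] at ha hab hb
    have h1 : ‖b.1 - a.1‖₊ ≤ 1 := by
      rw [← NNReal.coe_le_coe, coe_nnnorm, Real.norm_eq_abs, NNReal.coe_one, abs_le]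
      simp only at ha hb hab
      constructor <;> linarith [ha.1, hb.1, hab.1]
    have h2 : ‖b.2 - a.2‖₊ ≤ ‖(2 * Real.pi : ℝ)‖₊ := by
      rw [← NNReal.coe_le_coe, coe_nnnorm, coe_nnnorm, Real.norm_eq_abs, Real.norm_eq_abs,
        abs_of_pos (by positivity : 0 < 2 * Real.pi), abs_le]
      simp only at ha hb hab
      constructor <;> linarith [ha.2, hb.2, hab.2]
    rw [hD₀]; gcongr
  have hpiece : ∀ k : Fin 6, LipschitzOnWith (t.toNNReal * (K * D₀))
      (fun q ↦ t • polarMap (faceMap a b k q)) (Set.Icc (0 : Fin 2 → ℝ) 1) := by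
    intro k
    have hf : LipschitzOnWith D₀ (faceMap a b k) (Set.Icc (0 : Fin 2 → ℝ) 1) :=
      ((lipschitzWith_faceMap a b k).weaken hD).lipschitzOnWith
    have hcomp : LipschitzOnWith (K * D₀) (polarMap ∘ faceMap a b k) (Set.Icc (0 : Fin 2 → ℝ) 1) :=
      hK.comp hf fun q hq ↦ faceMap_mem_bigBox ha hab hb k hq
    exact Literature.Algebra.EuclideanLattices.lipschitzOnWith_smul hcomp ht0
  -- cover each piece
  have hcov : ∀ k : Fin 6, ∃ Y : Finset (ℝ × ℂ), (Y.card : ℝ) ≤ ((K : ℝ) * D₀ + 3) ^ 2 * t ^ 2 ∧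
      (fun q ↦ t • polarMap (faceMap a b k q)) '' Set.Icc (0 : Fin 2 → ℝ) 1 ⊆
        ⋃ y ∈ Y, Metric.closedBall y 1 := by
    intro k
    obtain ⟨Y, hY, hYcov⟩ := Literature.Algebra.EuclideanLattices.exists_cover_image_cube (hpiece k)
    refine ⟨Y, hY.trans ?_, hYcov⟩
    rw [NNReal.coe_mul, Real.coe_toNNReal _ ht0, NNReal.coe_mul]
    have hKD : 0 ≤ (K : ℝ) * D₀ := by positivity
    calc (t * ((K : ℝ) * D₀) + 3) ^ 2 ≤ (t * ((K : ℝ) * D₀) + 3 * t) ^ 2 := by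
          gcongr; linarith
      _ = ((K : ℝ) * D₀ + 3) ^ 2 * t ^ 2 := by ring
  choose Y hY hYcov using hcov
  refine ⟨Finset.univ.biUnion fun k ↦ (Y k).image (· + c), ?_, ?_⟩
  · calc ((Finset.univ.biUnion fun k ↦ (Y k).image (· + c)).card : ℝ)
        ≤ ∑ k, (((Y k).image (· + c)).card : ℝ) := by exact_mod_cast Finset.card_biUnion_le
      _ ≤ ∑ k : Fin 6, ((K : ℝ) * D₀ + 3) ^ 2 * t ^ 2 := Finset.sum_le_sum fun k _ ↦ by
          have h1 : (((Y k).image (· + c)).card : ℝ) ≤ (Y k).card := by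
            exact_mod_cast Finset.card_image_le
          exact h1.trans (hY k)
      _ = 6 * ((K : ℝ) * D₀ + 3) ^ 2 * t ^ 2 := by
          rw [Finset.sum_const, Finset.card_univ, Fintype.card_fin, nsmul_eq_mul]; push_cast; ring
  · -- `frontier (t • S + c) = (· + c) '' (t • frontier S)`
    have himg : (fun w ↦ t • w + c) '' sector a b = (Homeomorph.addRight c) '' (t • sector a b) := by
      rw [← Set.image_smul, Set.image_image]; rfl
    rw [himg, ← Homeomorph.image_frontier, Literature.Algebra.EuclideanLattices.frontier_smul htne]
    rintro w ⟨z, hz, rfl⟩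
    obtain ⟨x, hx, rfl⟩ := Set.mem_smul_set.1 hz
    rw [Prod.le_def] at ha hb
    have hfr := frontier_sector_subset (a := a) (b := b) (by simpa using ha.2) (by simpa using hb.2) hx
    obtain ⟨p, hp, rfl⟩ := hfr
    obtain ⟨k, hk⟩ := Set.mem_iUnion.1 (diff_subset_iUnion_faceMap hab hp)
    obtain ⟨q, hq, rfl⟩ := hk
    have hmem := hYcov k ⟨q, hq, rfl⟩
    simp only [Set.mem_iUnion, Metric.mem_closedBall, exists_prop] at hmem ⊢
    obtain ⟨y, hy, hdist⟩ := hmem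
    refine ⟨y + c, Finset.mem_biUnion.2 ⟨k, Finset.mem_univ _, Finset.mem_image.2 ⟨y, hy, rfl⟩⟩, ?_⟩
    simpa [Homeomorph.addRight, dist_eq_norm] using hdist

/-! ### The lattice `𝓞_K ⊂ W` and the uniform count -/

open MeasureTheory Module Submodule

/-- Lebesgue measure on `W = ℝ × ℂ` is an additive Haar measure (product of Haar measures; Mathlib
does not register this instance for product `volume`s). [folklore] -/
instance isAddHaarMeasure_volume_W : (volume : Measure (ℝ × ℂ)).IsAddHaarMeasure :=
  Measure.prod.instIsAddHaarMeasure volume volume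

/-- Coordinates `ℝ³ ≃ (Fin 3 → ℝ)`. [folklore] -/
def coordEquiv : (ℝ × ℝ × ℝ) ≃ₗ[ℝ] (Fin 3 → ℝ) where
  toFun p := ![p.1, p.2.1, p.2.2]
  invFun q := (q 0, q 1, q 2)
  map_add' p q := by ext i; fin_cases i <;> simp
  map_smul' c p := by ext i; fin_cases i <;> simp
  left_inv p := by simp
  right_inv q := by ext i; fin_cases i <;> simp

/-- The standard basis of `ℝ³`: `repr p i` is the `i`-th coordinate. [folklore] -/
def stdBasis3 : Basis (Fin 3) ℝ (ℝ × ℝ × ℝ) := Basis.ofEquivFun coordEquiv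

/-- `finrank ℝ ℝ³ = finrank ℝ W = 3`. [folklore] -/
theorem finrank_eq : finrank ℝ (ℝ × ℝ × ℝ) = finrank ℝ (ℝ × ℂ) := by
  simp [finrank_prod, Complex.finrank_real_complex]

/-- `dim W = 3`. [folklore] -/
theorem finrank_W : finrank ℝ (ℝ × ℂ) = 3 := by
  simp [finrank_prod, Complex.finrank_real_complex]

/-- **The Minkowski embedding as a linear isomorphism** `ℝ³ ≃ W`. [folklore] -/
def embWEquiv : (ℝ × ℝ × ℝ) ≃ₗ[ℝ] ℝ × ℂ := embW.linearEquivOfInjective embW_injective finrank_eq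

/-- Unfolding of `embWEquiv`. [folklore] -/
@[simp] theorem embWEquiv_apply (p : ℝ × ℝ × ℝ) : embWEquiv p = embW p := rfl

/-- **The lattice basis of `W`**: the images of the standard basis of `ℤ³ ⊂ ℝ³`, i.e. of
`1, ∛2, ∛4`. [cite: HeathBrownActa2001, §9 p. 53] -/
def basisW : Basis (Fin 3) ℝ (ℝ × ℂ) := stdBasis3.map embWEquiv

/-- The coordinates of `embW p` on `basisW` are the coordinates of `p`. [folklore] -/
theorem basisW_repr_embW (p : ℝ × ℝ × ℝ) (i : Fin 3) : basisW.repr (embW p) i = coordEquiv p i := by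
  rw [basisW, ← embWEquiv_apply, Basis.map_repr, LinearEquiv.trans_apply, LinearEquiv.symm_apply_apply,
    stdBasis3, Basis.ofEquivFun_repr_apply]

/-- **Lattice points are the images of the integer vectors**: `w ∈ span_ℤ basisW` iff
`w = embW v̂` for some `v ∈ ℤ³`. [folklore] -/
theorem mem_span_basisW_iff (w : ℝ × ℂ) :
    w ∈ span ℤ (Set.range basisW) ↔ ∃ v : ℤ × ℤ × ℤ, w = embW (castVec v) := by
  constructor
  · intro hw
    obtain ⟨p, rfl⟩ : ∃ p, embW p = w :=
      ⟨embWEquiv.symm w, by rw [← embWEquiv_apply, LinearEquiv.apply_symm_apply]⟩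
    rw [Basis.mem_span_iff_repr_mem] at hw
    have h : ∀ i, ∃ n : ℤ, (n : ℝ) = coordEquiv p i := fun i ↦ by
      obtain ⟨n, hn⟩ := hw i
      exact ⟨n, by rw [← basisW_repr_embW]; exact hn⟩
    choose n hn using h
    refine ⟨(n 0, n 1, n 2), ?_⟩
    congr 1
    have h0 := hn 0; have h1 := hn 1; have h2 := hn 2
    simp only [coordEquiv, LinearEquiv.coe_mk, LinearMap.coe_mk, AddHom.coe_mk, Matrix.cons_val_zero,
      Matrix.cons_val_one, Matrix.cons_val] at h0 h1 h2
    refine Prod.ext ?_ (Prod.ext ?_ ?_) <;> simp [castVec, h0, h1, h2]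
  · rintro ⟨v, rfl⟩
    rw [Basis.mem_span_iff_repr_mem]
    intro i
    rw [basisW_repr_embW]
    fin_cases i
    · exact ⟨v.1, by simp [coordEquiv, castVec]⟩
    · exact ⟨v.2.1, by simp [coordEquiv, castVec]⟩
    · exact ⟨v.2.2, by simp [coordEquiv, castVec]⟩

/-- **Counting integer vectors through the lattice**: for any set `S ⊆ W`,
`#{v ∈ ℤ³ : embW v̂ ∈ S} = #(S ∩ span_ℤ basisW)`. [folklore] -/
theorem ncard_preimage_eq_card_inter (S : Set (ℝ × ℂ)) :
    Nat.card {v : ℤ × ℤ × ℤ // embW (castVec v) ∈ S} =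
      Nat.card (S ∩ (span ℤ (Set.range basisW) : Set (ℝ × ℂ)) : Set (ℝ × ℂ)) := by
  refine Nat.card_congr (Equiv.ofBijective (fun v ↦ ⟨embW (castVec v.1), v.2,
    (mem_span_basisW_iff _).2 ⟨v.1, rfl⟩⟩) ⟨?_, ?_⟩)
  · rintro ⟨v, hv⟩ ⟨v', hv'⟩ h
    simp only [Subtype.mk.injEq] at h
    have := embW_injective h
    have hvv : v = v' := by
      have h1 := congrArg Prod.fst this
      have h2 := congrArg (fun p ↦ p.2.1) this
      have h3 := congrArg (fun p ↦ p.2.2) this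
      simp [castVec] at h1 h2 h3
      exact Prod.ext h1 (Prod.ext h2 h3)
    subst hvv; rfl
  · rintro ⟨w, hwS, hwL⟩
    obtain ⟨v, rfl⟩ := (mem_span_basisW_iff w).1 hwL
    exact ⟨⟨v, hwS⟩, rfl⟩

/-- The measure of a scaled and translated set: `vol(t S + c) = t³ vol(S)` (`t ≥ 0`). [folklore] -/
theorem volume_image_smul_add {t : ℝ} (ht : 0 ≤ t) (c : ℝ × ℂ) (S : Set (ℝ × ℂ)) :
    volume ((fun w ↦ t • w + c) '' S) = ENNReal.ofReal (t ^ 3) * volume S := by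
  have himg : (fun w ↦ t • w + c) '' S = (fun w ↦ w + c) '' (t • S) := by
    rw [← Set.image_smul, Set.image_image]
  rw [himg, Set.image_add_right, measure_preimage_add_right, Measure.addHaar_smul_of_nonneg _ ht,
    finrank_W]

/-- **Uniform lattice-point count in scaled, translated sectors** (Marcus, Ch. 6, Lemma 2, with the
constant uniform over the boxes `(0,−π) ≤ a ≤ b ≤ (1,π)` and over all translations): there is `C`
with `|#(𝓞_K-points in t·sector a b + c) − vol(sector a b) t³/vol(W/𝓞_K)| ≤ C t²` for `t ≥ 1`.
[cite: Marcus2018, Ch. 6, Lemma 2] -/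
theorem exists_uniform_sector_count :
    ∃ C : ℝ, ∀ a b : ℝ × ℝ, ((0 : ℝ), -Real.pi) ≤ a → a ≤ b → b ≤ ((1 : ℝ), Real.pi) →
      ∀ t : ℝ, 1 ≤ t → ∀ c : ℝ × ℂ,
        |(Nat.card (((fun w ↦ t • w + c) '' sector a b) ∩
              (span ℤ (Set.range basisW) : Set (ℝ × ℂ)) : Set (ℝ × ℂ)) : ℝ) -
            volume.real (sector a b) / volume.real (ZSpan.fundamentalDomain basisW) * t ^ 3| ≤
          C * t ^ 2 := by
  obtain ⟨C₀, hC₀, hcov⟩ := exists_cover_frontier_sector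
  set M : ℝ := volume.real (Metric.closedBall (0 : ℝ × ℂ)
      (1 + 2 * Literature.Algebra.EuclideanLattices.cellRadius basisW)) /
    volume.real (ZSpan.fundamentalDomain basisW) with hM
  have hM0 : 0 ≤ M := div_nonneg measureReal_nonneg measureReal_nonneg
  refine ⟨C₀ * M, fun a b ha hab hb t ht c ↦ ?_⟩
  have ht0 : 0 ≤ t := by linarith
  obtain ⟨Y, hYcard, hYcov⟩ := hcov a b ha hab hb t ht c
  -- boundedness of the scaled translated sector
  have hbdd : Bornology.IsBounded ((fun w ↦ t • w + c) '' sector a b) := by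
    obtain ⟨R, hR⟩ := (isBounded_sector a b).subset_closedBall 0
    refine (Metric.isBounded_closedBall (x := c) (r := t * R)).subset ?_
    rintro _ ⟨w, hw, rfl⟩
    have hwR : ‖w‖ ≤ R := by simpa using hR hw
    rw [Metric.mem_closedBall, dist_eq_norm, add_sub_cancel_right, norm_smul, Real.norm_of_nonneg ht0]
    exact mul_le_mul_of_nonneg_left hwR ht0
  have h := Literature.Algebra.EuclideanLattices.abs_card_sub_div_le_of_cover basisW volume hbdd hYcov
  have hvol : volume.real ((fun w ↦ t • w + c) '' sector a b) = t ^ 3 * volume.real (sector a b) := by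
    rw [measureReal_def, volume_image_smul_add ht0, ENNReal.toReal_mul,
      ENNReal.toReal_ofReal (by positivity), measureReal_def]
  rw [hvol] at h
  have e : volume.real (sector a b) / volume.real (ZSpan.fundamentalDomain basisW) * t ^ 3 =
      t ^ 3 * volume.real (sector a b) / volume.real (ZSpan.fundamentalDomain basisW) := by ring
  rw [e]
  calc _ ≤ Y.card * M := h
    _ ≤ C₀ * t ^ 2 * M := by gcongr
    _ = C₀ * M * t ^ 2 := by ring

/-! ### Congruent sectors have equal volume -/

/-- **Translating the box does not change the volume of the sector**: `sector (a + d) (b + d)` is the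
image of `sector a b` under the rotation by `d₂` composed with the unit flow by `d₁`, both of
determinant `1`. [folklore] -/
theorem volume_sector_add (a b d : ℝ × ℝ) : volume (sector (a + d) (b + d)) = volume (sector a b) := by
  have h1 : unitFlow d.1 '' sector a b = sector (a + (d.1, 0)) (b + (d.1, 0)) := image_unitFlow_sector _ _ _
  have h2 : rotW d.2 '' sector (a + (d.1, 0)) (b + (d.1, 0)) = sector (a + d) (b + d) := by
    rw [image_rotW_sector]
    congr 1 <;> ext <;> simp
  rw [← h2, ← h1, Measure.addHaar_image_linearMap, det_rotW, Measure.addHaar_image_linearMap,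
    det_unitFlow]
  simp

end Literature.NumberTheory.Sieve.CubicSieve
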